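import Summits.CriticalPhenomena.Ising3D.TaylorRegionQPoly
import Literature.MathematicalPhysics.QuantumFieldTheory.ConformalBootstrap3D.PointCertificate
import Mathlib.Tactic.Linarith
import Mathlib.Tactic.Positivity
import Mathlib.Tactic.Ring
import HarnessLib

/-!
# The identity term of a derivative certificate at `(½,½)`: closed form up to `κ = 2^{-(Δε-Δσ)}`
(cell `pub-ising3x`, seat boot-1; obligation (I) of `TaylorTermwiseObligations` made computable)

HONEST FRAMING: lottery ticket; floor = tightest certified 3D Ising CFT bounds; no exact-solution
claim without a proof.

The identity block is `1 = 𝒫_{0,0}` (the tree's `zMono_zero_zero`), so the identity term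
`α¹[F^{Δσ}_-[1]] + α²[F^{Δε}_-[1]] + α⁴[F^s_-[1]] + α⁵[F^s_+[1]]` of `α = taylorCrossing ½ ½ S w` is
`(½)^{2Δσ} Î₁ + (½)^{2Δε} Î₂ + (½)^{Δσ+Δε} (Î₄ + Î₅)` with the q-sums `Îᵢ = qSum (w ·) S (exponent) (sign) 0 0`
(`identityTerm_taylorCrossing_half`); dividing by `(½)^{2Δσ} > 0`: `identityTerm > 0 ↔ Î₁ + κ² Î₂ + κ (Î₄ + Î₅) > 0`
with `κ = (½)^{Δε-Δσ}` (`identityTerm_taylorCrossing_half_pos_iff`) — a rational check once `κ` is enclosed.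
Sources: Kos–Poland–Simmons-Duffin 2014 §3.2 eq. (3.15).
-/

namespace Summit.CriticalPhenomena.Ising3D

open Finset Set
open Literature.MathematicalPhysics.QuantumFieldTheory.ConformalBootstrap3D

/-- **The identity term at `(½,½)` in q-sums.** [cite: KosPolandSimmonsduffin2014, §3.2 eq. (3.15)] -/
theorem identityTerm_taylorCrossing_half (S : Finset (ℕ × ℕ)) (w : Fin 5 → ℕ × ℕ → ℝ) (Δσ Δε : ℝ) :
    (taylorCrossing (1 / 2) (1 / 2) S w).identityTerm Δσ Δε =
      (1 / 2 : ℝ) ^ (2 * Δσ) * qSum (w 0) S Δσ (-1) 0 0 +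
        (1 / 2 : ℝ) ^ (2 * Δε) * qSum (w 1) S Δε (-1) 0 0 +
        (1 / 2 : ℝ) ^ (2 * ((Δσ + Δε) / 2)) *
          (qSum (w 3) S ((Δσ + Δε) / 2) (-1) 0 0 + qSum (w 4) S ((Δσ + Δε) / 2) 1 0 0) := by
  have h00 : ((0 : ℕ) : ℝ) ≤ (0 : ℝ) := by norm_num
  have e1 := sum_smul_taylorCoeffAt_crossF_zMono_half (w 0) S Δσ (-1) 0 0 h00
  have e2 := sum_smul_taylorCoeffAt_crossF_zMono_half (w 1) S Δε (-1) 0 0 h00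
  have e4 := sum_smul_taylorCoeffAt_crossF_zMono_half (w 3) S ((Δσ + Δε) / 2) (-1) 0 0 h00
  have e5 := sum_smul_taylorCoeffAt_crossF_zMono_half (w 4) S ((Δσ + Δε) / 2) 1 0 0 h00
  rw [zMono_zero_zero, Real.rpow_zero, mul_one] at e1 e2 e4 e5
  unfold CrossingFunctional.identityTerm
  change (∑ ab ∈ S, w 0 ab • taylorCoeffAt (1 / 2) (1 / 2) ab) _ +
      (∑ ab ∈ S, w 1 ab • taylorCoeffAt (1 / 2) (1 / 2) ab) _ +
      (∑ ab ∈ S, w 3 ab • taylorCoeffAt (1 / 2) (1 / 2) ab) _ +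
      (∑ ab ∈ S, w 4 ab • taylorCoeffAt (1 / 2) (1 / 2) ab) _ = _
  rw [e1, e2, e4, e5]
  ring

/-- **(I) as a one-parameter check**: `identityTerm > 0 ↔ Î₁ + κ² Î₂ + κ (Î₄ + Î₅) > 0`, `κ = (½)^{Δε-Δσ}`.
[cite: KosPolandSimmonsduffin2014, §3.2 eq. (3.15)] -/
theorem identityTerm_taylorCrossing_half_pos_iff (S : Finset (ℕ × ℕ)) (w : Fin 5 → ℕ × ℕ → ℝ)
    (Δσ Δε : ℝ) :
    0 < (taylorCrossing (1 / 2) (1 / 2) S w).identityTerm Δσ Δε ↔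
      0 < qSum (w 0) S Δσ (-1) 0 0 + ((1 / 2 : ℝ) ^ (Δε - Δσ)) ^ 2 * qSum (w 1) S Δε (-1) 0 0 +
        (1 / 2 : ℝ) ^ (Δε - Δσ) *
          (qSum (w 3) S ((Δσ + Δε) / 2) (-1) 0 0 + qSum (w 4) S ((Δσ + Δε) / 2) 1 0 0) := by
  rw [identityTerm_taylorCrossing_half]
  have h0 : (0 : ℝ) < 1 / 2 := by norm_num
  have hP : 0 < (1 / 2 : ℝ) ^ (2 * Δσ) := Real.rpow_pos_of_pos h0 _
  have hκ2 : (1 / 2 : ℝ) ^ (2 * Δε) = (1 / 2 : ℝ) ^ (2 * Δσ) * ((1 / 2 : ℝ) ^ (Δε - Δσ)) ^ 2 := by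
    rw [sq, ← Real.rpow_add h0, ← Real.rpow_add h0]; congr 1; ring
  have hκ1 : (1 / 2 : ℝ) ^ (2 * ((Δσ + Δε) / 2)) = (1 / 2 : ℝ) ^ (2 * Δσ) * (1 / 2 : ℝ) ^ (Δε - Δσ) := by
    rw [← Real.rpow_add h0]; congr 1; ring
  rw [hκ2, hκ1]
  have key : (1 / 2 : ℝ) ^ (2 * Δσ) * qSum (w 0) S Δσ (-1) 0 0 +
      (1 / 2 : ℝ) ^ (2 * Δσ) * ((1 / 2 : ℝ) ^ (Δε - Δσ)) ^ 2 * qSum (w 1) S Δε (-1) 0 0 +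
      (1 / 2 : ℝ) ^ (2 * Δσ) * (1 / 2 : ℝ) ^ (Δε - Δσ) *
        (qSum (w 3) S ((Δσ + Δε) / 2) (-1) 0 0 + qSum (w 4) S ((Δσ + Δε) / 2) 1 0 0) =
      (1 / 2 : ℝ) ^ (2 * Δσ) * (qSum (w 0) S Δσ (-1) 0 0 +
        ((1 / 2 : ℝ) ^ (Δε - Δσ)) ^ 2 * qSum (w 1) S Δε (-1) 0 0 +
        (1 / 2 : ℝ) ^ (Δε - Δσ) *
          (qSum (w 3) S ((Δσ + Δε) / 2) (-1) 0 0 + qSum (w 4) S ((Δσ + Δε) / 2) 1 0 0)) := by ring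
  rw [key]
  exact mul_pos_iff_of_pos_left hP

end Summit.CriticalPhenomena.Ising3D
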